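import Mathlib
import Literature.Probability.Process.RenewalSequenceRecurrence

/-!
# Renewal sequences with a geometric envelope: persistence from exponential growth

Topic `Literature/Probability/Process`, continuing `RenewalSequenceRecurrence.lean` (same conventions: nonnegative
`u, f : ℕ → ℝ`, `u₀ = 1`, `0 ≤ uₙ ≤ 1`, `f₀ = 0`, renewal equation `uₙ = Σ_{k ≤ n} f_k u_{n-k}` for `n ≥ 1`).
Source for the qualitative dichotomy: W. Feller, *An Introduction to Probability Theory and Its Applications*, Vol. I,
3rd ed. (1968), XIII.3, Theorem 2 (`Σ f_k ≤ 1`, with equality iff `Σ uₙ = ∞`).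

What is typed here is an elementary, model-free PERSISTENCE CRITERION read off the radius of convergence (new in this
form, not printed as such):

**Theorem (`hasSum_f_one_of_envelope`).** If `f_k ≤ C r^k` for all `k` with `0 < r < 1` (the generating function
`F(s) = Σ f_k s^k` has radius `> 1`) and `uₙ sⁿ` is unbounded for every `s > 1` (the normalisation of `u` is
exponentially sharp, e.g. `n⁻¹ log uₙ → 0`), then `Σ f_k = 1`.

Proof: `Σ f ≤ 1` is Feller's (tree `Renewal.tsum_f_le_one`); if `F(1) < 1`, continuity of `F` on `[0, (1 + r⁻¹)/2]`
(`continuousOn_tsum`) gives `s₁ > 1` with `F(s₁) < 1`, and then by strong induction on the renewal equation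
`uₙ s₁ⁿ ≤ 1/(1 - F(s₁))` for all `n`, contradicting unboundedness.  Also recorded: under the envelope the mean
`Σ k f_k` is finite (`summable_mul_f_of_envelope`) and `Σ f_k s^k` converges for `r s < 1`
(`summable_f_mul_pow_of_envelope`).

Use (lane pcv-sawmu, ROUTES-G8 R35.4/R35.5): with `uₙ = Z^B_n(y) e^{-nλ_B(y)}` (pulled bridges on `ℤ²`, normalised by
the Fekete exponent) and `f` = the block law of irreducible pulled bridges, an explicit geometric envelope on `f` (the
three-crossings span bound + a certified free-energy window) yields the pulled Kesten relation `Σ f = 1` and a finite mean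
block length without generating-function analysis beyond this file.
-/

noncomputable section

open Finset Filter Topology

namespace Literature.Probability.Process.Renewal

variable {u f : ℕ → ℝ}

/-- Under a geometric envelope `f_k ≤ C r^k` (`0 < r < 1`) the weighted series `Σ f_k s^k` is summable for
`0 ≤ s` with `r s < 1`. [cite: Feller1968, XIII.3] -/
theorem summable_f_mul_pow_of_envelope (hf : ∀ k, 0 ≤ f k) {C r : ℝ} (hr : 0 < r)
    (henv : ∀ k, f k ≤ C * r ^ k) {s : ℝ} (hs : 0 ≤ s) (hrs : r * s < 1) :
    Summable fun k => f k * s ^ k := by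
  have hC : 0 ≤ C := by
    have := (hf 0).trans (henv 0); simpa using this
  refine Summable.of_nonneg_of_le (fun k => mul_nonneg (hf k) (pow_nonneg hs k)) (fun k => ?_)
    ((summable_geometric_of_lt_one (mul_nonneg hr.le hs) hrs).mul_left C)
  calc f k * s ^ k ≤ C * r ^ k * s ^ k := mul_le_mul_of_nonneg_right (henv k) (pow_nonneg hs k)
    _ = C * (r * s) ^ k := by rw [mul_pow]; ring

/-- **Persistence from exponential sharpness.** A renewal pair with a geometric envelope on `f` and
`uₙ sⁿ` unbounded for every `s > 1` has `Σ f_k = 1`. [cite: Feller1968, XIII.3 Theorem 2 (persistence)] -/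
theorem hasSum_f_one_of_envelope (hu0 : u 0 = 1) (hu : ∀ n, 0 ≤ u n) (hu1 : ∀ n, u n ≤ 1) (hf : ∀ k, 0 ≤ f k)
    (hf0 : f 0 = 0) (hren : ∀ n, 1 ≤ n → u n = ∑ k ∈ range (n + 1), f k * u (n - k))
    {C r : ℝ} (hr : 0 < r) (hr1 : r < 1) (henv : ∀ k, f k ≤ C * r ^ k)
    (hgrow : ∀ s : ℝ, 1 < s → ∀ M : ℝ, ∃ n, M < u n * s ^ n) : HasSum f 1 := by
  have hsum : Summable f := summable_f hu0 hu hu1 hf hf0 hren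
  have hle : ∑' k, f k ≤ 1 := tsum_f_le_one hu0 hu hu1 hf hf0 hren
  suffices h1 : ¬ (∑' k, f k < 1) by
    have : ∑' k, f k = 1 := le_antisymm hle (not_lt.1 h1)
    rw [← this]; exact hsum.hasSum
  intro hlt
  -- the generating function `F(s) = Σ f_k s^k` is continuous on `[0, s₂]`, `s₂ = (1 + r⁻¹)/2 > 1`
  set s₂ : ℝ := (1 + r⁻¹) / 2 with hs₂
  have hrinv : 1 < r⁻¹ := (one_lt_inv₀ hr).2 hr1
  have hs₂1 : 1 < s₂ := by rw [hs₂]; linarith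
  have hrs₂ : r * s₂ < 1 := by
    rw [hs₂]
    have : r * r⁻¹ = 1 := mul_inv_cancel₀ hr.ne'
    nlinarith
  have hC : 0 ≤ C := by have := (hf 0).trans (henv 0); simpa using this
  have hcont : ContinuousOn (fun s => ∑' k, f k * s ^ k) (Set.Icc 0 s₂) := by
    refine continuousOn_tsum (u := fun k => C * (r * s₂) ^ k) (fun k => ?_)
      ((summable_geometric_of_lt_one (by positivity) hrs₂).mul_left C) (fun k s hs => ?_)
    · exact (continuous_const.mul (continuous_pow k)).continuousOn
    · obtain ⟨hs0, hss⟩ := hs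
      rw [Real.norm_eq_abs, abs_of_nonneg (mul_nonneg (hf k) (pow_nonneg hs0 k))]
      calc f k * s ^ k ≤ C * r ^ k * s₂ ^ k :=
            mul_le_mul (henv k) (pow_le_pow_left₀ hs0 hss k) (pow_nonneg hs0 k) (mul_nonneg hC (pow_nonneg hr.le k))
        _ = C * (r * s₂) ^ k := by rw [mul_pow]; ring
  -- hence some `s₁ ∈ (1, s₂)` with `F(s₁) < 1`
  have h1mem : (1 : ℝ) ∈ Set.Icc 0 s₂ := ⟨zero_le_one, hs₂1.le⟩
  have hF1 : (∑' k, f k * (1 : ℝ) ^ k) = ∑' k, f k := by simp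
  have hev : ∀ᶠ s in 𝓝[Set.Icc 0 s₂] 1, (∑' k, f k * s ^ k) < 1 := by
    have ht := hcont.continuousWithinAt h1mem
    rw [ContinuousWithinAt, hF1] at ht
    exact ht (Iio_mem_nhds hlt)
  have hsub : Set.Ioo 1 s₂ ⊆ Set.Icc 0 s₂ := fun s hs => ⟨by linarith [hs.1], hs.2.le⟩
  have hev' : ∀ᶠ s in 𝓝[Set.Ioo 1 s₂] 1, (∑' k, f k * s ^ k) < 1 ∧ s ∈ Set.Ioo 1 s₂ :=
    (hev.filter_mono (nhdsWithin_mono _ hsub)).and eventually_mem_nhdsWithin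
  haveI : (𝓝[Set.Ioo 1 s₂] (1 : ℝ)).NeBot := left_nhdsWithin_Ioo_neBot hs₂1
  obtain ⟨s₁, hFs₁, hs₁1, hs₁2⟩ := hev'.exists
  -- `F(s₁)` as a bound for partial sums, and the induction `uₙ s₁ⁿ ≤ 1/(1 − F(s₁))`
  have hs₁0 : 0 ≤ s₁ := by linarith
  have hsumF : Summable fun k => f k * s₁ ^ k :=
    summable_f_mul_pow_of_envelope hf hr henv hs₁0 (by nlinarith)
  set F := ∑' k, f k * s₁ ^ k with hFdef
  have hF0 : 0 ≤ F := tsum_nonneg fun k => mul_nonneg (hf k) (pow_nonneg hs₁0 k)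
  set M := 1 / (1 - F) with hM
  have hM0 : 0 < M := by rw [hM]; exact div_pos one_pos (by linarith)
  have hpartial : ∀ n, ∑ k ∈ range (n + 1), f k * s₁ ^ k ≤ F := fun n =>
    hsumF.sum_le_tsum _ (fun k _ => mul_nonneg (hf k) (pow_nonneg hs₁0 k))
  have hbound : ∀ n, u n * s₁ ^ n ≤ M := by
    intro n
    induction n using Nat.strong_induction_on with
    | _ n ih =>
      rcases Nat.eq_zero_or_pos n with rfl | hn
      · rw [hu0, pow_zero, one_mul, hM, le_div_iff₀ (by linarith)]; nlinarith
      · rw [hren n hn, Finset.sum_mul]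
        have hterm : ∀ k ∈ range (n + 1), f k * u (n - k) * s₁ ^ n ≤ f k * s₁ ^ k * M := by
          intro k hk
          have hkn : k ≤ n := Nat.lt_succ_iff.1 (Finset.mem_range.1 hk)
          rcases Nat.eq_zero_or_pos k with rfl | hk0
          · rw [hf0]; simp
          · have hih := ih (n - k) (by omega)
            calc f k * u (n - k) * s₁ ^ n = f k * s₁ ^ k * (u (n - k) * s₁ ^ (n - k)) := by
                  rw [← pow_sub_mul_pow s₁ hkn]; ring
              _ ≤ f k * s₁ ^ k * M :=
                  mul_le_mul_of_nonneg_left hih (mul_nonneg (hf k) (pow_nonneg hs₁0 k))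
        calc ∑ k ∈ range (n + 1), f k * u (n - k) * s₁ ^ n
            ≤ ∑ k ∈ range (n + 1), f k * s₁ ^ k * M := Finset.sum_le_sum hterm
          _ = (∑ k ∈ range (n + 1), f k * s₁ ^ k) * M := by rw [Finset.sum_mul]
          _ ≤ F * M := mul_le_mul_of_nonneg_right (hpartial n) hM0.le
          _ ≤ M := by
              have h1F : 0 < 1 - F := by linarith
              rw [hM, ← sub_nonneg]
              have : 1 / (1 - F) - F * (1 / (1 - F)) = 1 := by field_simp
              linarith
  obtain ⟨n, hn⟩ := hgrow s₁ hs₁1 M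
  exact absurd (hbound n) (not_le.2 hn)

/-- Under a geometric envelope the mean `Σ k f_k` is finite. [cite: Feller1968, XIII.3] -/
theorem summable_mul_f_of_envelope (hf : ∀ k, 0 ≤ f k) {C r : ℝ} (hr : 0 < r) (hr1 : r < 1)
    (henv : ∀ k, f k ≤ C * r ^ k) : Summable fun k : ℕ => (k : ℝ) * f k := by
  have hC : 0 ≤ C := by have := (hf 0).trans (henv 0); simpa using this
  have hg : Summable fun k : ℕ => ((k : ℝ) ^ 1 : ℝ) * r ^ k :=
    summable_pow_mul_geometric_of_norm_lt_one 1 (by rwa [Real.norm_eq_abs, abs_of_pos hr])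
  refine Summable.of_nonneg_of_le (fun k => mul_nonneg (Nat.cast_nonneg k) (hf k)) (fun k => ?_) (hg.mul_left C)
  calc (k : ℝ) * f k ≤ (k : ℝ) * (C * r ^ k) := mul_le_mul_of_nonneg_left (henv k) (Nat.cast_nonneg k)
    _ = C * ((k : ℝ) ^ 1 * r ^ k) := by ring

end Literature.Probability.Process.Renewal
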